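import Summits.Ventures.CertifiedManyBodySolver.Transport.ChainWindowReflection
import Summits.Ventures.CertifiedManyBodySolver.Transport.ChainWindowSpinFlip
import HarnessLib

/-!
# Ventures/CertifiedManyBodySolver — Transport/ChainWindowReflectionSign.lean

Speedrun cell sr-mbsolver — LIT team (lit-1 gen-7), LEAD r118 (c) "STAGE 3", part B2b: THE REFLECTION UNITARY (signs) AND ITS ROWS.
HONEST FRAMING: first certified bounds; not a superconductivity verdict; every number certified or labelled float.

The Fock unitary of the chain reflection `p ↦ k−1−p` of op-08's `k = n+3`-site window (`code/oplayer/fockspace.py`: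
`reflection`, the automorphism `c_{p,σ} ↦ c_{k−1−p,σ}` applied letter by letter to `c†_{m₁}⋯c†_{m_r}|vac⟩`) is, in the
occupation basis `|0⟩,|↑⟩,|↓⟩,|↑↓⟩` per site, the signed permutation
`reflectionOp n = S · P · V`, `P = permOp r` (part B2a), `V = ⨂_x d`, `d = diag(1,1,1,−1)`, `S = diag((−1)^{N(N−1)/2})`:
the Jordan–Wigner reordering sign of a reflected occupation list is `(−1)^{#pairs of particles on distinct sites}
= (−1)^{N(N−1)/2} · (−1)^{#doubly occupied sites}`. This file (part 1 of 2) proves: the one-site identities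
`d (c†_σ F) d = c†_σ`, `d c_σ d = F c_σ`, `d (F c_σ) d = c_σ`, `d c†_σ d = c†_σ F`, `d n_σ d = n_σ`, `d (n_↑n_↓) d = n_↑n_↓`, `u d = d u`
(`u` the spin flip); that `V = ⨂_x d` preserves sector zeros and reality and commutes with every site permutation; and that
`W = P · V` carries the bond density `h_bond(x, x+1)` to the bond density of the reflected bond read in increasing order,
`h_bond(r(x+1), r(x))` (the twist `d` restores the Jordan–Wigner orientation of the hopping term). Part 2
(`ChainWindowReflectionRows.lean`) assembles the rows of the ENT / `tl_marginal` node, `W² = 1`, and the sector sign `S`.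
No sorry, no axiom; the one definition is the explicit matrix `uDouble` (with body).
[cite: KullEtAl2024, §II.B, §VI.B] [cite: EsslerEtAl2005, §12.3.4 eqs. (12.196)–(12.201)] [cite: BratteliRobinsonII1997, §6.2.1]
-/

noncomputable section

open Matrix Complex
open scoped ComplexOrder BigOperators
open Literature.Probability.LatticeModels
open Literature.MathematicalPhysics.QuantumLattice
open Literature.MathematicalPhysics.QuantumLattice.HubbardWave0
open Literature.MathematicalPhysics.QuantumLattice.JordanWigner
open Literature.InformationTheory.Entropy (vonNeumannEntropy)

namespace Summit.Ventures.CertifiedManyBodySolver.Transport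

/-! ### §1 The on-site sign `d = diag(1,1,1,−1)` -/

section Site

/-- **The one-site reflection sign** `d = diag(1,1,1,−1)` in the basis `|0⟩, |↑⟩, |↓⟩, |↑↓⟩` (the doubly occupied site picks up
the Jordan–Wigner sign of exchanging its two orbitals' positions relative to the rest). [cite: EsslerEtAl2005, §12.3.4 eq. (12.196)] -/
def uDouble : Matrix (Fin 4) (Fin 4) ℂ := !![1, 0, 0, 0; 0, 1, 0, 0; 0, 0, 1, 0; 0, 0, 0, -1]

/-- `d` is a signed permutation with `p = id`, `t = (1, 1, 1, −1)`. [folklore] -/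
theorem uDouble_apply (a b : Fin 4) :
    uDouble a b = if b = (fun c : Fin 4 => c) a then (![1, 1, 1, -1] : Fin 4 → ℂ) a else 0 := by
  fin_cases a <;> fin_cases b <;> simp [uDouble]

/-- `d² = 1`. [folklore] -/
theorem uDouble_mul_self : uDouble * uDouble = 1 := by
  ext a b; fin_cases a <;> fin_cases b <;> simp [uDouble, Matrix.mul_apply, Fin.sum_univ_four]

/-- `dᴴ = d`. [folklore] -/
theorem uDouble_conjTranspose : uDoubleᴴ = uDouble := by
  ext a b; fin_cases a <;> fin_cases b <;> simp [uDouble, Matrix.conjTranspose_apply]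

/-- `d` is unitary. [folklore] -/
theorem uDouble_mem_unitaryGroup : uDouble ∈ Matrix.unitaryGroup (Fin 4) ℂ := by
  rw [Matrix.mem_unitaryGroup_iff, Matrix.star_eq_conjTranspose, uDouble_conjTranspose, uDouble_mul_self]

/-- `d (c†_σ F) d = c†_σ`. [cite: EsslerEtAl2005, §12.3.4 eqs. (12.198)–(12.201)] -/
theorem uDouble_conj_siteCreation_mul_siteParity (σ : Fin 2) :
    uDouble * (siteCreation σ * siteParity) * uDoubleᴴ = siteCreation σ := by
  rw [uDouble_conjTranspose]
  have h0 : uDouble * (siteCreation 0 * siteParity) * uDouble = siteCreation 0 := by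
    rw [siteCreation_zero_mul_siteParity, siteCreation_zero_eq]
    ext a b; fin_cases a <;> fin_cases b <;> simp [uDouble, Matrix.mul_apply, Fin.sum_univ_four]
  have h1 : uDouble * (siteCreation 1 * siteParity) * uDouble = siteCreation 1 := by
    rw [siteCreation_one_mul_siteParity, siteCreation_one_eq]
    ext a b; fin_cases a <;> fin_cases b <;> simp [uDouble, Matrix.mul_apply, Fin.sum_univ_four]
  fin_cases σ
  · exact h0
  · exact h1

/-- `d c_σ d = F c_σ`. [cite: EsslerEtAl2005, §12.3.4 eqs. (12.198)–(12.201)] -/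
theorem uDouble_conj_siteAnnihilation (σ : Fin 2) :
    uDouble * siteAnnihilation σ * uDoubleᴴ = siteParity * siteAnnihilation σ := by
  rw [uDouble_conjTranspose]
  have h0 : uDouble * siteAnnihilation 0 * uDouble = siteParity * siteAnnihilation 0 := by
    rw [siteParity_mul_siteAnnihilation_zero, siteAnnihilation_zero_eq]
    ext a b; fin_cases a <;> fin_cases b <;> simp [uDouble, Matrix.mul_apply, Fin.sum_univ_four]
  have h1 : uDouble * siteAnnihilation 1 * uDouble = siteParity * siteAnnihilation 1 := by
    rw [siteParity_mul_siteAnnihilation_one, siteAnnihilation_one_eq]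
    ext a b; fin_cases a <;> fin_cases b <;> simp [uDouble, Matrix.mul_apply, Fin.sum_univ_four]
  fin_cases σ
  · exact h0
  · exact h1

/-- `d (F c_σ) d = c_σ`. [cite: EsslerEtAl2005, §12.3.4 eqs. (12.198)–(12.201)] -/
theorem uDouble_conj_siteParity_mul_siteAnnihilation (σ : Fin 2) :
    uDouble * (siteParity * siteAnnihilation σ) * uDoubleᴴ = siteAnnihilation σ := by
  rw [uDouble_conjTranspose]
  have h0 : uDouble * (siteParity * siteAnnihilation 0) * uDouble = siteAnnihilation 0 := by
    rw [siteParity_mul_siteAnnihilation_zero, siteAnnihilation_zero_eq]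
    ext a b; fin_cases a <;> fin_cases b <;> simp [uDouble, Matrix.mul_apply, Fin.sum_univ_four]
  have h1 : uDouble * (siteParity * siteAnnihilation 1) * uDouble = siteAnnihilation 1 := by
    rw [siteParity_mul_siteAnnihilation_one, siteAnnihilation_one_eq]
    ext a b; fin_cases a <;> fin_cases b <;> simp [uDouble, Matrix.mul_apply, Fin.sum_univ_four]
  fin_cases σ
  · exact h0
  · exact h1

/-- `d c†_σ d = c†_σ F`. [cite: EsslerEtAl2005, §12.3.4 eqs. (12.198)–(12.201)] -/
theorem uDouble_conj_siteCreation (σ : Fin 2) :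
    uDouble * siteCreation σ * uDoubleᴴ = siteCreation σ * siteParity := by
  rw [uDouble_conjTranspose]
  have h0 : uDouble * siteCreation 0 * uDouble = siteCreation 0 * siteParity := by
    rw [siteCreation_zero_mul_siteParity, siteCreation_zero_eq]
    ext a b; fin_cases a <;> fin_cases b <;> simp [uDouble, Matrix.mul_apply, Fin.sum_univ_four]
  have h1 : uDouble * siteCreation 1 * uDouble = siteCreation 1 * siteParity := by
    rw [siteCreation_one_mul_siteParity, siteCreation_one_eq]
    ext a b; fin_cases a <;> fin_cases b <;> simp [uDouble, Matrix.mul_apply, Fin.sum_univ_four]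
  fin_cases σ
  · exact h0
  · exact h1

/-- `d (n_↑ n_↓) d = n_↑ n_↓`. [cite: EsslerEtAl2005, §12.3.4 eq. (12.196)] -/
theorem uDouble_conj_siteDouble : uDouble * siteDouble * uDoubleᴴ = siteDouble := by
  rw [uDouble_conjTranspose, siteDouble_eq]
  ext a b; fin_cases a <;> fin_cases b <;> simp [uDouble, Matrix.mul_apply, Fin.sum_univ_four]

/-- `d n_σ d = n_σ`. [cite: EsslerEtAl2005, §12.3.4 eq. (12.196)] -/
theorem uDouble_conj_siteNumber (σ : Fin 2) : uDouble * siteNumber σ * uDoubleᴴ = siteNumber σ := by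
  rw [uDouble_conjTranspose]
  have h0 : uDouble * siteNumber 0 * uDouble = siteNumber 0 := by
    rw [siteNumber_zero_eq]
    ext a b; fin_cases a <;> fin_cases b <;> simp [uDouble, Matrix.mul_apply, Fin.sum_univ_four]
  have h1 : uDouble * siteNumber 1 * uDouble = siteNumber 1 := by
    rw [siteNumber_one_eq]
    ext a b; fin_cases a <;> fin_cases b <;> simp [uDouble, Matrix.mul_apply, Fin.sum_univ_four]
  fin_cases σ
  · exact h0
  · exact h1

/-- The spin flip and the sign `d` commute on one site. [folklore] -/
theorem uSpinFlip_mul_uDouble : uSpinFlip * uDouble = uDouble * uSpinFlip := by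
  ext a b; fin_cases a <;> fin_cases b <;> simp [uDouble, uSpinFlip, Matrix.mul_apply, Fin.sum_univ_four]

end Site

/-! ### §2 `V = ⨂_x d` and `W = P · V` on a window; generic conjugation facts -/

section Window

variable {Y : Type} [Fintype Y] [DecidableEq Y]

/-- `V² = 1`. [folklore] -/
theorem dbl_mul_self : productOp (fun _ : Y => uDouble) * productOp (fun _ : Y => uDouble) = 1 := by
  rw [productOp_mul]
  simp only [uDouble_mul_self, productOp_one]

omit [DecidableEq Y] in
/-- `Vᴴ = V`. [folklore] -/
theorem dbl_conjTranspose : (productOp (fun _ : Y => uDouble))ᴴ = productOp (fun _ : Y => uDouble) := by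
  rw [productOp_conjTranspose]
  simp only [uDouble_conjTranspose]

omit [DecidableEq Y] in
/-- `V` is diagonal with signs `∏_x t(k_x)`, `t = (1,1,1,−1)`. [folklore] -/
theorem dbl_apply (k l : TensorIndex Y 4) :
    productOp (fun _ : Y => uDouble) k l =
      if l = (fun y => (fun c : Fin 4 => c) (k y)) then ∏ y, (![1, 1, 1, -1] : Fin 4 → ℂ) (k y) else 0 :=
  productOp_apply_of_signedPerm (u := fun _ : Y => uDouble) (fun _ => fun c : Fin 4 => c) (fun _ => ![1, 1, 1, -1])
    (fun _ a b => uDouble_apply a b) k l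

/-- **Sector zeros survive `V`.** [folklore] -/
theorem dbl_sectorRow {ρ : Op Y 4}
    (hρ : ∀ σ : Fin 2, ∀ k k' : TensorIndex Y 4,
      (∑ x, if σ ∈ siteOcc (k x) then 1 else 0 : ℕ) ≠ (∑ x, if σ ∈ siteOcc (k' x) then 1 else 0 : ℕ) → ρ k k' = 0)
    (σ : Fin 2) (k k' : TensorIndex Y 4)
    (hk : (∑ x, if σ ∈ siteOcc (k x) then 1 else 0 : ℕ) ≠ (∑ x, if σ ∈ siteOcc (k' x) then 1 else 0 : ℕ)) :
    (productOp (fun _ : Y => uDouble) * ρ * (productOp (fun _ : Y => uDouble))ᴴ) k k' = 0 :=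
  sectorRow_signedPerm_conj (fun k y => (fun c : Fin 4 => c) (k y)) _ dbl_apply
    (fun (σ : Fin 2) (k : TensorIndex Y 4) => (∑ x, if σ ∈ siteOcc (k x) then 1 else 0 : ℕ)) (fun τ _ _ hl => ⟨τ, hl⟩)
    hρ σ k k' hk

/-- **Real entries survive `V`.** [folklore] -/
theorem dbl_realRow {ρ : Op Y 4} (hρ : ∀ k k', starRingEnd ℂ (ρ k k') = ρ k k') (k k' : TensorIndex Y 4) :
    starRingEnd ℂ ((productOp (fun _ : Y => uDouble) * ρ * (productOp (fun _ : Y => uDouble))ᴴ) k k') =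
      (productOp (fun _ : Y => uDouble) * ρ * (productOp (fun _ : Y => uDouble))ᴴ) k k' := by
  refine realRow_signedPerm_conj _ _ dbl_apply (fun l => ?_) hρ k k'
  rw [star_prod]
  refine Finset.prod_congr rfl fun y _ => ?_
  generalize l y = a
  fin_cases a <;> simp

variable {q : ℕ}

/-- **A site permutation fixes a constant product operator**: `P (⨂_x u) Pᴴ = ⨂_x u`. [cite: BratteliRobinsonII1997, §6.2.1] -/
theorem permOp_conj_productOp_const (e : Y ≃ Y) (u : Matrix (Fin q) (Fin q) ℂ) :
    permOp e * productOp (fun _ : Y => u) * (permOp e)ᴴ = productOp (fun _ : Y => u) := by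
  rw [permOp_mul_mul_conjTranspose]
  ext σ τ
  rw [reindexOp_apply, productOp_apply, productOp_apply]
  exact e.prod_comp (fun x => u (σ x) (τ x))

/-- Hence `P` and `⨂_x u` commute. [cite: BratteliRobinsonII1997, §6.2.1] -/
theorem permOp_mul_productOp_const (e : Y ≃ Y) (u : Matrix (Fin q) (Fin q) ℂ) :
    permOp e * productOp (fun _ : Y => u) = productOp (fun _ : Y => u) * permOp e := by
  have h := congrArg (· * (permOp e : Op Y q)) (permOp_conj_productOp_const e u)
  simp only at h
  rwa [Matrix.mul_assoc, conjTranspose_permOp_mul, Matrix.mul_one] at h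

/-- From `W H Wᴴ = H` and `Wᴴ W = 1`: `Wᴴ H W = H`. [folklore] -/
theorem conjTranspose_conj_of_conj {W H : Op Y q} (hW : Wᴴ * W = 1) (h : W * H * Wᴴ = H) : Wᴴ * H * W = H := by
  calc Wᴴ * H * W = Wᴴ * (W * H * Wᴴ) * W := by rw [h]
    _ = (Wᴴ * W) * H * (Wᴴ * W) := by simp only [Matrix.mul_assoc]
    _ = H := by rw [hW, Matrix.one_mul, Matrix.mul_one]

/-- `(P V) A (P V)ᴴ = P (V A Vᴴ) Pᴴ`. [folklore] -/
theorem mul_conj_eq (P V A : Op Y q) : (P * V) * A * (P * V)ᴴ = P * (V * A * Vᴴ) * Pᴴ := by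
  rw [Matrix.conjTranspose_mul]
  simp only [Matrix.mul_assoc]

/-- **`W = P · V` carries a product of on-site factors to the reflected sites, twisting each by `d`.** [cite: BratteliRobinsonII1997, §6.2.1] -/
theorem reflW_conj_onSite_mul_onSite (e : Y ≃ Y) (x y : Y) (a b : Matrix (Fin 4) (Fin 4) ℂ) :
    (permOp e * productOp (fun _ : Y => uDouble)) * (onSite x a * onSite y b) * (permOp e * productOp (fun _ : Y => uDouble))ᴴ =
      onSite (e x) (uDouble * a * uDoubleᴴ) * onSite (e y) (uDouble * b * uDoubleᴴ) := by
  have hu : ∀ _ : Y, uDoubleᴴ * uDouble = 1 := fun _ => by rw [uDouble_conjTranspose, uDouble_mul_self]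
  have hu' : ∀ _ : Y, uDouble * uDoubleᴴ = 1 := fun _ => by rw [uDouble_conjTranspose, uDouble_mul_self]
  rw [mul_conj_eq, productOp_conj_mul hu, productOp_conj_onSite hu', productOp_conj_onSite hu', reflect_conj_onSite_mul_onSite]

/-- `W (onSite x a) Wᴴ = onSite (e x) (d a d)`. [cite: BratteliRobinsonII1997, §6.2.1] -/
theorem reflW_conj_onSite (e : Y ≃ Y) (x : Y) (a : Matrix (Fin 4) (Fin 4) ℂ) :
    (permOp e * productOp (fun _ : Y => uDouble)) * onSite x a * (permOp e * productOp (fun _ : Y => uDouble))ᴴ =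
      onSite (e x) (uDouble * a * uDoubleᴴ) := by
  rw [mul_conj_eq, productOp_conj_onSite (fun _ => by rw [uDouble_conjTranspose, uDouble_mul_self]), reflect_conj_onSite]

end Window

/-! ### §3 The bond density under `W`: `h_bond(x, x+1) ↦ h_bond(r(x+1), r(x))` -/

section Bond

variable {Λ : Finset (Site 1)}

/-- **`W` carries the bond density of `(x, y = x+1)` to the bond density of `(x', y') = (r y, r x)`** whenever `r x = y'`,
`r y = x'`, `y' = x' + 1`: the twist `d` turns `(c†_σ F)_x (c_σ)_y` into `(c†_σ)_{y'} (F c_σ)_{x'} = (F c_σ)_{x'} (c†_σ)_{y'}`, i.e.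
the reflected bond read in increasing order. [cite: EsslerEtAl2005, §12.3.4 eqs. (12.196)–(12.201)] [cite: KullEtAl2024, §II.B] -/
theorem reflW_conj_toSpin_tlmBond (t U : ℝ) (e : PolySite Λ ≃ PolySite Λ) {x y x' y' : Site 1}
    (hx : x ∈ Λ) (hy : y ∈ Λ) (hx' : x' ∈ Λ) (hy' : y' ∈ Λ) (h : y 0 = x 0 + 1) (h' : y' 0 = x' 0 + 1)
    (hex : e (PolySite.pt x hx) = PolySite.pt y' hy') (hey : e (PolySite.pt y hy) = PolySite.pt x' hx') :
    (permOp e * productOp (fun _ : PolySite Λ => uDouble)) * toSpin (tlmBond t U x y hx hy) *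
        (permOp e * productOp (fun _ : PolySite Λ => uDouble))ᴴ = toSpin (tlmBond t U x' y' hx' hy') := by
  have hne : PolySite.pt y' hy' ≠ PolySite.pt x' hx' := by
    intro heq
    have h1 := congrArg (fun z : PolySite Λ => ofLex z.1 0) heq
    simp only [PolySite.ofLex_coe_pt] at h1
    omega
  rw [toSpin_tlmBond_of_succ t U hx hy h, toSpin_tlmBond_of_succ t U hx' hy' h', conj_add, conj_smul, conj_smul, conj_sum,
    conj_add, reflW_conj_onSite, reflW_conj_onSite, uDouble_conj_siteDouble, hex, hey,
    add_comm (onSite (PolySite.pt y' hy') siteDouble)]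
  congr 2
  refine Finset.sum_congr rfl fun σ _ => ?_
  rw [conj_add, reflW_conj_onSite_mul_onSite, reflW_conj_onSite_mul_onSite, uDouble_conj_siteCreation_mul_siteParity,
    uDouble_conj_siteAnnihilation, uDouble_conj_siteParity_mul_siteAnnihilation, uDouble_conj_siteCreation, hex, hey,
    onSite_mul_onSite_comm hne, onSite_mul_onSite_comm hne (siteAnnihilation σ), add_comm]

end Bond

end Summit.Ventures.CertifiedManyBodySolver.Transport
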